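import Summits.BirchSwinnertonDyer.BirchSwinnertonDyer.Theorems.GenusKolyvaginAtTwoShaCardDvdPowAtTwoPosTOnCut
import Summits.BirchSwinnertonDyer.BirchSwinnertonDyer.Theorems.GenusKolyvaginAtTwoShaCardDvdPowAtTwoRTShaFiniteAtTwoPairCountOfB2
import HarnessLib

/-!
# Route `GenusKolyvaginAtTwo`, crux U⁺_T `ShaCardDvdPowAtTwoPosT` (stmt-BirchSwinnertonDyer-23378, `Δ > 0`) and the additive-only residual
# `AdditiveOnlyResidualAtTwoNegDisc` (stmt-BirchSwinnertonDyer-24826, `Δ < 0`, no odd multiplicative prime): THE UPPER HALF ON THE CUT,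
# CLOSED MODULO PRINT — `#Ш(E/K)[2^∞] ∣ 4^(M₀)` GRANTED Kolyvagin 1989 Theorem B₂ (named Literature fact `Kolyvagin1989_theoremB_two`)

Seat `bsd-line-gk2-p3` g27 (PROVER seat 3/3, cell `bsd-f1-sign2`), `--supports stmt-BirchSwinnertonDyer-23378` (helper; closes nothing).
THEOREMS ONLY (no definition, no new named fact, no `sorry`); standard axioms.  CONDITIONAL on the displayed PRINT antecedent
`hB2 : Kolyvagin1989_theoremB_two (W.conductorNorm ℤ) W K` (Kolyvagin, Izv. 33 (1989) Thm. B_l at `l = 2`: `[E(K) : ℤy_K] · Ш(E/ℚ)[2^∞] = 0`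
for `r_an(E) = 0`, `ρ_{E,2^∞}` onto, `K ∉ {ℚ(i), ℚ(√−2), ℚ(√−|Δ|), ℚ(√−2|Δ|)}` — NO Tamagawa, NO reduction-type, NO sign-of-`Δ` hypothesis; unproved in
the tree, size XL).  BSD is NOT proved by any of this; U⁺_T / Q4_T / 24826 AS FILED are NOT proved; no item is closed.

WHY.  The sign-free descent half (`…PosTOnCut`, this seat) reduces the upper half of Kolyvagin-exactness at `2` on the cut — on BOTH signs of `Δ`
and WITHOUT an odd multiplicative prime — to the `ℚ`-side sharp exponent `2^(M₀) · Ш(E/ℚ)[2^∞] = 0`.  In the tree that exponent is a THEOREM only on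
`Δ < 0` with an odd multiplicative prime (gk2-p4 g22's B2Q, through NPh at the multiplicative prime); LINE 16_T's regular-prime B2Q⁺ (gk2-p5 g31 /
gk2-p4 g23) is in flight.  In PRINT it is Kolyvagin's Theorem B₂, sign- and reduction-free; gk2-p5 g29 wired B₂ to the exponent on U_T's habitat
(`…RTShaFiniteAtTwoPairCountOfB2`, `2^(M₀+1) ∤ [E(K) : ℤy_K]` from `rank E(K) = 1` — there by Kolyvagin's descent over `K`).  Here the same
wiring runs FROM THE CUT ALONE (`rank E(K) = 1` from `rank E(ℚ) = 0` + the `2`-Selmer-minimal twin + `y_K` of infinite order, `…PosTOnCut` §0):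

* §1 `mordellWeilRank_baseChange_eq_one_of_cut`, `not_two_pow_succ_dvd_index_zmultiples_heegner_of_cut` — `rank E(K) = 1` and the Heegner-index
  certificate `2^(M₀+1) ∤ [E(K) : ℤy_K]`, `[E(K) : ℤy_K] ≠ 0`, from the cut (McCallum Lemma 5.1 = tree `Additive.exists_zsmul_eq_of_pow_dvd_index`).
* §2 `forall_sha_two_pow_smul_eq_zero_of_kolyvaginB_two_of_cut` — GRANTED `hB2` and `r_an(E) = 0`: the B2Q-shape `∀ k a, a ∈ Ш(E/ℚ) → 2^k a = 0 →
  2^(M₀) a = 0` on the cut, ANY sign, NO multiplicative prime (the X5 door `HeegnerIndexDoor.sha_two_pow_smul_eq_zero_of_kolyvaginB_two`).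
* §3 **`natCard_primaryComponent_sha_two_dvd_pow_onOddTwinCut_of_kolyvaginB_two`** (`Δ > 0`, Tamagawa-odd Sel₂-minimal twin) and
  **`natCard_primaryComponent_sha_two_dvd_pow_onCut_of_kolyvaginB_two`** (`Δ < 0`, `ord₂ C(Wd) ≤ 1`, NO multiplicative prime — covers the
  additive-only residual's U-part): **`#Ш(E/K)[2^∞] ∣ 2^(2M₀)` GRANTED `hB2`** (`rank E(ℚ) = 0` displayed: in `closes` it is `r_an(E) = 0` + GZK).

HONEST FRAMING: conditional results (one PRINT antecedent, displayed); the unconditional discharge of `hB2` on the cut is exactly B2Q⁺ (one deep /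
regular Kolyvagin prime per Selmer class over `ℚ`).  Beyond print: no.  BSD is NOT proved; nothing is closed.

References: [Kolyvagin1989Izv] Thm. B_l (l = 2), pp. 475–476, §3 pp. 484–490, Prop. 16; [McCallumLMS1991] Lemma 5.1, §5 Cor. 5.6; [GrossLMS1991]
§1 Thm. 1.3, §5 Prop. 5.3; [Kramer1981] Thm. 1; [MazurRubin2010] Cor. 3.4 (i); [SilvermanAEC2009] Thm. X.4.2, Exercise 10.16.
-/

set_option autoImplicit false
set_option linter.dupNamespace false -- `Summit.<P>.<Sub>` repeats `BirchSwinnertonDyer` (D-0017)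

noncomputable section

open scoped Classical
open scoped AddSubgroup

namespace Summit.BirchSwinnertonDyer.BirchSwinnertonDyer.Theorems.GenusExact.PlusDescent

open Literature.NumberTheory.EllipticCurves Literature.NumberTheory.GaloisRepresentations WeierstrassCurve NumberField
  IsDedekindDomain Field AddSubgroup Literature.NumberTheory.EllipticCurves.ModularForms
  Literature.NumberTheory.EllipticCurves.RingClassField
open Summit.BirchSwinnertonDyer.Rank1Residual

variable (W : WeierstrassCurve ℚ) [W.IsElliptic] [W.IsGloballyMinimal] [NeZero (W.conductorNorm ℤ)]
variable (K : Type) [Field K] [NumberField K]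

/-! ## §1 `rank E(K) = 1` and the Heegner-index certificate from the cut -/

/-- **`rank E(K) = 1` on the cut, sign-free**: `rank E(K) = rank E(ℚ) + rank E^(d_K)(ℚ)` (Mordell–Weil, Silverman Exercise 10.16) with
`rank E(ℚ) = 0`, `rank E^(d_K)(ℚ) ≤ 1` from `#Sel₂(Wd) = 2`, and `≥ 1` from the Heegner point of infinite order.
[cite: SilvermanAEC2009, Thm. X.4.2 (a), Exercise 10.16] [cite: GrossLMS1991, §1 Thm. 1.3] -/
theorem mordellWeilRank_baseChange_eq_one_of_cut (hIQ : IsImaginaryQuadratic K) (hHe : SatisfiesHeegnerHypothesis (W.conductorNorm ℤ) K)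
    (hs2 : W.HasSurjectiveModNGaloisRep 2)
    (Dt : ModularParametrizationData W (W.conductorNorm ℤ)) (β : ℤ) (ι : K →+* ℂ) (d₁ : KolyvaginHeegnerData Dt β ι 1)
    (hy : ¬ IsOfFinAddOrder d₁.derivedPoint) (M₀ : ℕ)
    (hndiv : ¬ ∃ Q : (W.baseChange (ringClassField K ι 1)).toAffine.Point, ((2 ^ (M₀ + 1) : ℕ) : ℤ) • Q = d₁.derivedPoint)
    (hw : W.rootNumber = 1) (hrk0 : W.mordellWeilRank = 0)
    (Wd : WeierstrassCurve ℚ) [Wd.IsElliptic] (hWd : ∃ C : VariableChange ℚ, C • W.quadraticTwist (NumberField.discr K : ℚ) = Wd)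
    (hSel : Nat.card (Wd.selmerGroup 2) = 2) :
    (W.baseChange K).mordellWeilRank = 1 := by
  haveI hell : (W.baseChange K).IsElliptic := inferInstanceAs ((W.map (algebraMap ℚ K)).IsElliptic)
  obtain ⟨τ, hτ, -⟩ := exists_conj_of_isImaginaryQuadratic (K := K) hIQ
  obtain ⟨-, hrk, -, -⟩ := exists_frame_of_cut W K hIQ hHe hs2 hτ Dt β ι d₁ hy M₀ hndiv hw hrk0 Wd hWd hSel
  obtain ⟨Ph, -, hPhmap⟩ := AdditiveKoly.exists_isHeegnerPoint_map_eq_derivedPoint_one (W := W) (K := K) (Dt := Dt) (β := β)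
    (ι := ι) hIQ hHe d₁
  have hPhnt : ¬ IsOfFinAddOrder Ph := fun h ↦ hy (by rw [← hPhmap]; exact AddMonoidHom.isOfFinAddOrder _ h)
  haveI : Module.Finite ℤ (W.baseChange K).toAffine.Point := (W.baseChange K).module_finite_point_holds
  have hK1 : 1 ≤ (W.baseChange K).mordellWeilRank :=
    one_le_mordellWeilRank_of_not_isOfFinAddOrder (W.baseChange K) inferInstance hPhnt
  omega

/-- **The Heegner-index certificate from the cut: `[E(K) : ℤy] ≠ 0` and `2^(M₀+1) ∤ [E(K) : ℤy]`** for the `K`-rational Heegner point `y ↦ P(1)`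
(sign-free, no multiplicative prime): `rank E(K) = 1` (§1), `E(K)[2] = 0` (`ρ̄_{W,2}` onto), McCallum's Lemma 5.1 (`2^(M₀+1) ∣ index ⟹ y ∈ 2^(M₀+1)E(K)`,
tree `Additive.exists_zsmul_eq_of_pow_dvd_index`) and the frame's `2^(M₀+1) ∤ P(1)`.  (gk2-p5 g29's `not_two_pow_succ_dvd_index_zmultiples_heegner_onHabitat`
with the habitat replaced by the cut.)  [cite: McCallumLMS1991, Lemma 5.1 (p. 303)] [cite: GrossLMS1991, §1 Thm. 1.3, §4] -/
theorem not_two_pow_succ_dvd_index_zmultiples_heegner_of_cut (hIQ : IsImaginaryQuadratic K)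
    (hHe : SatisfiesHeegnerHypothesis (W.conductorNorm ℤ) K) (hs2 : W.HasSurjectiveModNGaloisRep 2)
    (Dt : ModularParametrizationData W (W.conductorNorm ℤ)) (β : ℤ) (ι : K →+* ℂ) (d₁ : KolyvaginHeegnerData Dt β ι 1)
    (hy : ¬ IsOfFinAddOrder d₁.derivedPoint) (M₀ : ℕ)
    (hndiv : ¬ ∃ Q : (W.baseChange (ringClassField K ι 1)).toAffine.Point, ((2 ^ (M₀ + 1) : ℕ) : ℤ) • Q = d₁.derivedPoint)
    (hw : W.rootNumber = 1) (hrk0 : W.mordellWeilRank = 0)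
    (Wd : WeierstrassCurve ℚ) [Wd.IsElliptic] (hWd : ∃ C : VariableChange ℚ, C • W.quadraticTwist (NumberField.discr K : ℚ) = Wd)
    (hSel : Nat.card (Wd.selmerGroup 2) = 2)
    {P₀ : (W.baseChange K).toAffine.Point}
    (hP₀ : WeierstrassCurve.Affine.Point.map (W' := W) (algebraMap K (ringClassField K ι 1)).toRatAlgHom P₀ = d₁.derivedPoint) :
    (AddSubgroup.zmultiples P₀).index ≠ 0 ∧ ¬ 2 ^ (M₀ + 1) ∣ (AddSubgroup.zmultiples P₀).index := by
  haveI hell : (W.baseChange K).IsElliptic := inferInstanceAs ((W.map (algebraMap ℚ K)).IsElliptic)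
  haveI : AddGroup.FG (W.baseChange K).toAffine.Point := (W.baseChange K).addGroup_fg_point_holds
  have h2 : Module.finrank ℚ K = 2 := hIQ.1
  have hP₀nt : ¬ IsOfFinAddOrder P₀ := fun h ↦ hy (by rw [← hP₀]; exact AddMonoidHom.isOfFinAddOrder _ h)
  have hrank := mordellWeilRank_baseChange_eq_one_of_cut W K hIQ hHe hs2 Dt β ι d₁ hy M₀ hndiv hw hrk0 Wd hWd hSel
  have hidx : (AddSubgroup.zmultiples P₀).index ≠ 0 :=
    index_zmultiples_ne_zero_of_finrank_eq_one hP₀nt (by rw [← hrank]; rfl)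
  refine ⟨hidx, fun hdvd ↦ ?_⟩
  have hA : ∀ a : (W.baseChange K).toAffine.Point, ((2 : ℕ) : ℤ) • a = 0 → a = 0 := fun a ha ↦
    EigenClassesFinite.forall_zsmul_two_pow_baseChange_eq_zero_of_hasSurjectiveModNGaloisRep_two W K h2 hs2 1 a (by simpa using ha)
  obtain ⟨Q, hQ⟩ := Additive.exists_zsmul_eq_of_pow_dvd_index Nat.prime_two hA hP₀nt hidx hdvd
  exact forall_two_pow_smul_ne_bottom_of_not_dvd_derivedPoint d₁ P₀ hP₀ le_rfl hndiv Q hQ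

/-! ## §2 The B2Q-shape on the cut GRANTED Kolyvagin's Theorem B₂ (any sign, no multiplicative prime) -/

/-- **The `ℚ`-side sharp exponent on the cut, GRANTED Kolyvagin 1989 Theorem B₂** (`hB2`, named Literature fact, unproved) and `r_an(E) = 0`:
every `a ∈ Ш(E/ℚ)` of `2`-power order satisfies `2^(M₀) a = 0` — Kolyvagin's printed `[E(K) : ℤy_K] · Ш(E/ℚ)[2^∞] = 0` (the X5 door
`HeegnerIndexDoor.sha_two_pow_smul_eq_zero_of_kolyvaginB_two`) with the certificate of §1.  ANY sign of `Δ`, NO multiplicative prime, NO Tamagawa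
hypothesis; the four field exclusions of B₂ are `d_K` odd (`≠ −4, −8`) and the frame's two non-square conditions.  CONDITIONAL on `hB2`.
[cite: Kolyvagin1989Izv, Thm. B_l (l = 2), p. 475–476] [cite: McCallumLMS1991, Lemma 5.1] -/
theorem forall_sha_two_pow_smul_eq_zero_of_kolyvaginB_two_of_cut (hB2 : Kolyvagin1989_theoremB_two (W.conductorNorm ℤ) W K)
    (hIQ : IsImaginaryQuadratic K) (hodd : Odd (NumberField.discr K)) (h3 : NumberField.discr K ≠ -3)
    (hHe : SatisfiesHeegnerHypothesis (W.conductorNorm ℤ) K)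
    (hsq1 : ¬ IsSquare ((NumberField.discr K : ℚ) * -|W.Δ|)) (hsq2 : ¬ IsSquare ((NumberField.discr K : ℚ) * (-(2 * |W.Δ|))))
    (hρ : ∀ n : ℕ, 0 < n → W.HasSurjectiveModNGaloisRep ((2 : ℤ) ^ n)) (hr0 : W.analyticRank = 0)
    (Dt : ModularParametrizationData W (W.conductorNorm ℤ)) (β : ℤ) (ι : K →+* ℂ) (d₁ : KolyvaginHeegnerData Dt β ι 1)
    (hy : ¬ IsOfFinAddOrder d₁.derivedPoint) (M₀ : ℕ)
    (hndiv : ¬ ∃ Q : (W.baseChange (ringClassField K ι 1)).toAffine.Point, ((2 ^ (M₀ + 1) : ℕ) : ℤ) • Q = d₁.derivedPoint)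
    (hw : W.rootNumber = 1) (hrk0 : W.mordellWeilRank = 0)
    (Wd : WeierstrassCurve ℚ) [Wd.IsElliptic] (hWd : ∃ C : VariableChange ℚ, C • W.quadraticTwist (NumberField.discr K : ℚ) = Wd)
    (hSel : Nat.card (Wd.selmerGroup 2) = 2) :
    ∀ (k : ℕ) (a : W.galH1), a ∈ W.sha → ((2 ^ k : ℕ) : ℤ) • a = 0 → ((2 ^ M₀ : ℕ) : ℤ) • a = 0 := by
  have hs2 : W.HasSurjectiveModNGaloisRep 2 := by simpa using hρ 1 one_pos
  obtain ⟨P₀, hHP, hP₀⟩ := AdditiveKoly.exists_isHeegnerPoint_map_eq_derivedPoint_one (W := W) (K := K) (Dt := Dt) (β := β) (ι := ι)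
    hIQ hHe d₁
  have hP₀nt : ¬ IsOfFinAddOrder P₀ := fun h ↦ hy (by rw [← hP₀]; exact AddMonoidHom.isOfFinAddOrder _ h)
  obtain ⟨-, hI⟩ := not_two_pow_succ_dvd_index_zmultiples_heegner_of_cut W K hIQ hHe hs2 Dt β ι d₁ hy M₀ hndiv hw hrk0 Wd hWd hSel hP₀
  have h4 : NumberField.discr K ≠ -4 := fun h ↦ by
    rw [h] at hodd
    exact (Int.not_even_iff_odd.mpr hodd) ⟨-2, by norm_num⟩
  have h8 : NumberField.discr K ≠ -8 := fun h ↦ by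
    rw [h] at hodd
    exact (Int.not_even_iff_odd.mpr hodd) ⟨-4, by norm_num⟩
  have hkill := X5.HeegnerIndexDoor.sha_two_pow_smul_eq_zero_of_kolyvaginB_two W hB2 hIQ hHe h3 h4 hHP hP₀nt hr0 hρ h8 hsq1 hsq2 hI
  intro k a ha hka
  have h := hkill ⟨a, ha⟩ k (Subtype.ext (by rw [AddSubgroupClass.coe_nsmul, ZeroMemClass.coe_zero, ← natCast_zsmul]; exact hka))
  have h' := congrArg Subtype.val h
  rw [AddSubgroupClass.coe_nsmul, ZeroMemClass.coe_zero] at h'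
  rw [natCast_zsmul]
  exact h'

/-! ## §3 The upper half on the cut, both signs, GRANTED Kolyvagin's Theorem B₂ -/

/-- **U⁺_T ON THE `Δ > 0` CUT, CLOSED MODULO PRINT**: `W/ℚ` globally minimal, `C(W)` odd, `Δ_W > 0`, `r_an(E) = 0`, `rank E(ℚ) = 0`, `ρ_{E,2^n}`
onto for all `n ≥ 1`; `K` imaginary quadratic, `d_K` odd `≠ −3`, Heegner, the two non-square conditions; the frame `(Dt, β, ι, d₁)` with `P(1)` of
infinite order and `2^(M₀+1) ∤ P(1)`; `w(E) = +1`; an elliptic `Wd ≅ E^(d_K)` with `#Sel₂(Wd) = 2` and `ord₂ C(Wd) = 0`; GRANTED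
`Kolyvagin1989_theoremB_two`: **`#Ш(E/K)[2^∞] ∣ 2^(2M₀)`**.  NO multiplicative prime, NO Kolyvagin descent over `K`.  CONDITIONAL on `hB2`.
[cite: Kolyvagin1989Izv, Thm. B_l (l = 2)] [cite: Kramer1981, Thm. 1] [cite: MazurRubin2010, Cor. 3.4 (i)] [cite: McCallumLMS1991, §5 Cor. 5.6] -/
theorem natCard_primaryComponent_sha_two_dvd_pow_onOddTwinCut_of_kolyvaginB_two
    (hB2 : Kolyvagin1989_theoremB_two (W.conductorNorm ℤ) W K) (hT : Odd W.tamagawaProduct) (hpos : 0 < W.Δ)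
    (hIQ : IsImaginaryQuadratic K) (hodd : Odd (NumberField.discr K)) (h3 : NumberField.discr K ≠ -3)
    (hHe : SatisfiesHeegnerHypothesis (W.conductorNorm ℤ) K)
    (hsq1 : ¬ IsSquare ((NumberField.discr K : ℚ) * -|W.Δ|)) (hsq2 : ¬ IsSquare ((NumberField.discr K : ℚ) * (-(2 * |W.Δ|))))
    (hρ : ∀ n : ℕ, 0 < n → W.HasSurjectiveModNGaloisRep ((2 : ℤ) ^ n)) (hr0 : W.analyticRank = 0)
    (Dt : ModularParametrizationData W (W.conductorNorm ℤ)) (β : ℤ) (ι : K →+* ℂ) (d₁ : KolyvaginHeegnerData Dt β ι 1)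
    (hy : ¬ IsOfFinAddOrder d₁.derivedPoint) (M₀ : ℕ)
    (hndiv : ¬ ∃ Q : (W.baseChange (ringClassField K ι 1)).toAffine.Point, ((2 ^ (M₀ + 1) : ℕ) : ℤ) • Q = d₁.derivedPoint)
    (hw : W.rootNumber = 1) (hrk0 : W.mordellWeilRank = 0)
    (Wd : WeierstrassCurve ℚ) [Wd.IsElliptic] (hWd : ∃ C : VariableChange ℚ, C • W.quadraticTwist (NumberField.discr K : ℚ) = Wd)
    (hSel : Nat.card (Wd.selmerGroup 2) = 2) (hDEF : padicValNat 2 Wd.tamagawaProduct = 0) :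
    Nat.card (AddCommGroup.primaryComponent (W.baseChange K).sha 2) ∣ 2 ^ (2 * M₀) :=
  natCard_primaryComponent_sha_two_dvd_pow_onOddTwinCut_of_shaExponent W K hT hpos hIQ hodd hHe (by simpa using hρ 1 one_pos) Dt β ι d₁ hy
    M₀ hndiv hw hrk0 Wd hWd hSel hDEF
    (forall_sha_two_pow_smul_eq_zero_of_kolyvaginB_two_of_cut W K hB2 hIQ hodd h3 hHe hsq1 hsq2 hρ hr0 Dt β ι d₁ hy M₀ hndiv hw hrk0 Wd hWd hSel)

/-- **U ON THE `Δ < 0` CUT WITHOUT A MULTIPLICATIVE PRIME, CLOSED MODULO PRINT** (the U-part of the additive-only residual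
`AdditiveOnlyResidualAtTwoNegDisc`, stmt-BirchSwinnertonDyer-24826, on LINE 19's cut `ord₂ C(Wd) ≤ 1`): same as the `Δ > 0` version, GRANTED
`Kolyvagin1989_theoremB_two`: **`#Ш(E/K)[2^∞] ∣ 2^(2M₀)`**.  CONDITIONAL on `hB2`.
[cite: Kolyvagin1989Izv, Thm. B_l (l = 2)] [cite: Kramer1981, Thm. 1] [cite: MazurRubin2010, Cor. 3.4 (i)] [cite: McCallumLMS1991, §5 Cor. 5.6] -/
theorem natCard_primaryComponent_sha_two_dvd_pow_onCut_of_kolyvaginB_two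
    (hB2 : Kolyvagin1989_theoremB_two (W.conductorNorm ℤ) W K) (hT : Odd W.tamagawaProduct) (hneg : W.Δ < 0)
    (hIQ : IsImaginaryQuadratic K) (hodd : Odd (NumberField.discr K)) (h3 : NumberField.discr K ≠ -3)
    (hHe : SatisfiesHeegnerHypothesis (W.conductorNorm ℤ) K)
    (hsq1 : ¬ IsSquare ((NumberField.discr K : ℚ) * -|W.Δ|)) (hsq2 : ¬ IsSquare ((NumberField.discr K : ℚ) * (-(2 * |W.Δ|))))
    (hρ : ∀ n : ℕ, 0 < n → W.HasSurjectiveModNGaloisRep ((2 : ℤ) ^ n)) (hr0 : W.analyticRank = 0)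
    (Dt : ModularParametrizationData W (W.conductorNorm ℤ)) (β : ℤ) (ι : K →+* ℂ) (d₁ : KolyvaginHeegnerData Dt β ι 1)
    (hy : ¬ IsOfFinAddOrder d₁.derivedPoint) (M₀ : ℕ)
    (hndiv : ¬ ∃ Q : (W.baseChange (ringClassField K ι 1)).toAffine.Point, ((2 ^ (M₀ + 1) : ℕ) : ℤ) • Q = d₁.derivedPoint)
    (hw : W.rootNumber = 1) (hrk0 : W.mordellWeilRank = 0)
    (Wd : WeierstrassCurve ℚ) [Wd.IsElliptic] (hWd : ∃ C : VariableChange ℚ, C • W.quadraticTwist (NumberField.discr K : ℚ) = Wd)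
    (hSel : Nat.card (Wd.selmerGroup 2) = 2) (hDEF : padicValNat 2 Wd.tamagawaProduct ≤ 1) :
    Nat.card (AddCommGroup.primaryComponent (W.baseChange K).sha 2) ∣ 2 ^ (2 * M₀) :=
  natCard_primaryComponent_sha_two_dvd_pow_onCut_of_shaExponent W K hT hneg hIQ hodd hHe (by simpa using hρ 1 one_pos) Dt β ι d₁ hy M₀
    hndiv hw hrk0 Wd hWd hSel hDEF
    (forall_sha_two_pow_smul_eq_zero_of_kolyvaginB_two_of_cut W K hB2 hIQ hodd h3 hHe hsq1 hsq2 hρ hr0 Dt β ι d₁ hy M₀ hndiv hw hrk0 Wd hWd hSel)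

end Summit.BirchSwinnertonDyer.BirchSwinnertonDyer.Theorems.GenusExact.PlusDescent

end
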